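import Literature.Computability.QuantumComplexity.QFTStagePlaced
import Literature.Computability.QuantumComplexity.CoreDescAbstract
import HarnessLib

/-!
# The abstract gate list of the Fourier block (`QFTWord.blockCircuit`, `QFTStage.block`)

Topic `Literature/Computability/QuantumComplexity`; a companion of `QFTBlockWord.lean` / `QFTStagePlaced.lean` for
UNIFORMITY proofs in the abstract-gate-list style of `CoreDescAbstract.lean` (stage S4 of the uniformity of the machine
sampler of [Regev2009, Lemma 3.14]). The Fourier block on `κ` qubits is `chainCircuit blockWords`, round `j` being the
controlled-phase words of the pairs `(j, l)` (the OAA word of a diagonal sandwich of the phase gadget, for `j < l`; empty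
otherwise) followed by one Hadamard gate. We prove the SHAPE of its abstract word:

* `QFTWord.map_toAG_qftPhaseWord` — a controlled-phase word abstracts to
  `oaaWordA (phaseSandwichA had ((phaseOps kit ws j l).map (ClOp.map Fin.val)) [cr] [flag]) (reflectA cr (as ++ region) hs)`;
* `QFTWord.pairA`, `map_toAG_pairWord`, `map_toAG_hadWord`;
* **`QFTWord.roundA`, `QFTWord.map_toAG_blockCircuit`** — `(blockCircuit hk hW hP).gates.map toAG =
  (List.finRange κ).flatMap roundA`, `roundA j = [H (ws j)] ++ (List.finRange κ).reverse.flatMap (pairA j)`;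
* `QFTStage.map_toAG_block` — the same for the concrete block of the stage.

What remains for the uniformity of the stage is to compute `(phaseOps kit ws j l).map (ClOp.map Fin.val)`, the flags and
the kit's wire lists on codes for the concrete kit `QFTKit.kit κ k`. Everything is proved; no named fact is introduced.

## References

* O. Regev, *On lattices, learning with errors, random linear codes, and cryptography*, J. ACM 56(6) (2009), Lemma 3.14
  (proof) [Regev2009].
* M. A. Nielsen, I. L. Chuang, *Quantum Computation and Quantum Information*, CUP 2010, §5.1 (the QFT circuit)
  [NielsenChuang2010].
* S. Arora, B. Barak, *Computational Complexity: A Modern Approach*, CUP 2009, §6.2 and proof of Thm. 6.15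
  [AroraBarak2009].
-/

noncomputable section

namespace Literature.Computability.QuantumComplexity

open _root_.Computability Cryptography AJLCore

namespace QFTWord

variable {N κ : ℕ} {kit : GadgetKit N} (hk : kit.OK) {ws : Fin κ ↪ Fin N} (hW : WiresOK kit ws)

section Pair

variable (j l : Fin κ) (hjl : j < l) (hP : ProgOK kit j l)

/-- **The abstract gate list of a controlled-phase word.** [cite: NielsenChuang2010, §5.1]
[cite: AroraBarak2009, §6.2 and proof of Thm. 6.15] -/
theorem map_toAG_qftPhaseWord : (qftPhaseWord hk hW j l hjl hP).gates.map toAG =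
    oaaWordA (phaseSandwichA ((kit.cr :: kit.as).map Fin.val) ((phaseOps kit ws j l).map (ClOp.map Fin.val)) [(kit.cr : ℕ)]
      [(phaseFlag kit ws j l : ℕ)]) (reflectA kit.cr ((kit.as ++ kit.region).map Fin.val) (kit.hs.map Fin.val)) := by
  rw [qftPhaseWord, map_toAG_oaaWordCircuit, map_toAG_phaseSandwichCircuit, map_toAG_reflectCircuit]
  rfl

end Pair

section Block

variable (hP : ∀ j l : Fin κ, j < l → ProgOK kit j l)

/-- **The abstract word of the pair `(j, l)`**: the controlled-phase word for `j < l`, empty otherwise. [folklore] -/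
def pairA (j l : Fin κ) : List AG :=
  if j < l then
    oaaWordA (phaseSandwichA ((kit.cr :: kit.as).map Fin.val) ((phaseOps kit ws j l).map (ClOp.map Fin.val)) [(kit.cr : ℕ)]
      [(phaseFlag kit ws j l : ℕ)]) (reflectA kit.cr ((kit.as ++ kit.region).map Fin.val) (kit.hs.map Fin.val))
  else []

/-- The pair word abstracts to `pairA`. [folklore] -/
theorem map_toAG_pairWord (j l : Fin κ) : (pairWord hk hW hP j l).gates.map toAG = pairA (kit := kit) (ws := ws) j l := by
  unfold pairWord pairA
  split_ifs with h
  · exact map_toAG_qftPhaseWord hk hW j l h (hP j l h)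
  · rfl

/-- The Hadamard word abstracts to one `H`. [folklore] -/
theorem map_toAG_hadWord (j : Fin κ) : (hadWord ws j).gates.map toAG = [⟨.H, [(ws j : ℕ)]⟩] := rfl

/-- **The abstract word of round `j`** (in gate order): the Hadamard gate, then the pair words for `l = κ-1, …, 0`.
[cite: NielsenChuang2010, §5.1] -/
def roundA (j : Fin κ) : List AG := [⟨.H, [(ws j : ℕ)]⟩] ++ (List.finRange κ).reverse.flatMap fun l => pairA (kit := kit) (ws := ws) j l

/-- The gates of round `j`, reversed word by word, abstract to `roundA j`. [folklore] -/
theorem map_toAG_roundWords_reverse (j : Fin κ) :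
    ((roundWords hk hW hP j).reverse.flatMap QCircuit.gates).map toAG = roundA (kit := kit) (ws := ws) j := by
  rw [roundWords, List.reverse_append, List.reverse_singleton, List.singleton_append, List.flatMap_cons, List.map_append,
    map_toAG_hadWord, roundA, List.map_flatMap, List.ofFn_eq_map, ← List.map_reverse, List.flatMap_map]
  congr 1
  exact List.flatMap_congr fun l _ => map_toAG_pairWord hk hW hP j l

/-- **The abstract gate list of the Fourier block**: the rounds `j = 0, …, κ-1`, each the Hadamard gate followed by the
pair words. [cite: NielsenChuang2010, §5.1] [cite: AroraBarak2009, §6.2 and proof of Thm. 6.15] -/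
theorem map_toAG_blockCircuit :
    (blockCircuit hk hW hP).gates.map toAG = (List.finRange κ).flatMap (roundA (kit := kit) (ws := ws)) := by
  rw [blockCircuit, gates_chainCircuit, blockWords, List.reverse_flatten, List.map_reverse, List.reverse_reverse, List.map_ofFn,
    List.flatten_eq_flatMap, List.flatMap_assoc, List.map_flatMap, List.ofFn_eq_map, List.flatMap_map]
  exact List.flatMap_congr fun j _ => map_toAG_roundWords_reverse hk hW hP j

end Block

end QFTWord

namespace QFTStage

/-- **The abstract gate list of the stage's Fourier block.** [cite: NielsenChuang2010, §5.1] -/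
theorem map_toAG_block {k κ : ℕ} (hk1 : 1 ≤ k) :
    (block (κ := κ) hk1).gates.map toAG =
      (List.finRange κ).flatMap (QFTWord.roundA (kit := QFTKit.kit κ k) (ws := QFTKit.dataEmb κ k)) :=
  QFTWord.map_toAG_blockCircuit _ _ _

end QFTStage

end Literature.Computability.QuantumComplexity

end
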